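import Summits.RiemannHypothesis.RiemannHypothesis.Theses.WeilSemilocal
import Summits.RiemannHypothesis.RiemannHypothesis.Theorems.WeilSemilocalWallsTenKGapSplit
import Summits.RiemannHypothesis.RiemannHypothesis.Theorems.WeilSemilocalWallsTenKTwin
import Summits.RiemannHypothesis.RiemannHypothesis.Theorems.WeilSemilocalWallsTenKNonTwin

/-!
# Split closure of `SemilocalWallsToTenThousand` (gate-written; R5, gate window 13, 2026-08-30)

Item stmt-RiemannHypothesis-19395 of route route-RiemannHypothesis-WeilSemilocal (`Summits.RiemannHypothesis.RiemannHypothesis.Theses.WeilSemilocal`) was split (gen 1) into 2 children + glue,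
and every child and the glue is closed·proved by an accepted theorem. This module states the derived theorem, so the parent's closer is a
real kernel-checked declaration (rulings 21-frontier F1/F2, 2026-08-30). Do not edit by hand: the gate regenerates it when the family changes.

children: WallsTenKTwin (stmt-RiemannHypothesis-19172, `Summit.RiemannHypothesis.RiemannHypothesis.Theorems.WeilSemilocalRoute.wallsTenKTwin_proof`); WallsTenKNonTwin (stmt-RiemannHypothesis-19173, `Summit.RiemannHypothesis.RiemannHypothesis.Theorems.WeilSemilocalRoute.wallsTenKNonTwin_proof`)
glue: WallsTenKGapSplit (stmt-RiemannHypothesis-19174, `Summit.RiemannHypothesis.RiemannHypothesis.Theorems.WeilSemilocalRoute.wallsTenKGapSplit_proof`)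
-/

namespace Summit.RiemannHypothesis.RiemannHypothesis.Theorems.SplitClosure.WeilSemilocal

/-- `SemilocalWallsToTenThousand` holds BY SPLIT (gen 1): the glue applied to the proved children. -/
theorem SemilocalWallsToTenThousand_holds : _root_.Summit.RiemannHypothesis.RiemannHypothesis.Theses.WeilSemilocal.SemilocalWallsToTenThousand :=
  (show _root_.Summit.RiemannHypothesis.RiemannHypothesis.Theses.WeilSemilocal.WallsTenKTwin → _root_.Summit.RiemannHypothesis.RiemannHypothesis.Theses.WeilSemilocal.WallsTenKNonTwin → _root_.Summit.RiemannHypothesis.RiemannHypothesis.Theses.WeilSemilocal.SemilocalWallsToTenThousand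
    from _root_.Summit.RiemannHypothesis.RiemannHypothesis.Theorems.WeilSemilocalRoute.wallsTenKGapSplit_proof)
    (show _root_.Summit.RiemannHypothesis.RiemannHypothesis.Theses.WeilSemilocal.WallsTenKTwin from _root_.Summit.RiemannHypothesis.RiemannHypothesis.Theorems.WeilSemilocalRoute.wallsTenKTwin_proof)
    (show _root_.Summit.RiemannHypothesis.RiemannHypothesis.Theses.WeilSemilocal.WallsTenKNonTwin from _root_.Summit.RiemannHypothesis.RiemannHypothesis.Theorems.WeilSemilocalRoute.wallsTenKNonTwin_proof)

end Summit.RiemannHypothesis.RiemannHypothesis.Theorems.SplitClosure.WeilSemilocal
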